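import Literature.AlgebraicGeometry.Limits.LocalizationActionSpread          -- ★ `LocApprox.exists_monoidHom_aut_stage` (FILE 1∕2, A-p03)
import Literature.AlgebraicGeometry.Motives.IntegralModelOfGlobalModel        -- ★ `IntegralModel.localise`, `towerIsoOver`, `towerLeftIso_hom_fst∕_snd`
import Literature.AlgebraicGeometry.RelativeSpec.ActionOverBaseChange         -- ★ `RelativeSpec.ActionOver` over `SchemeOver`
import Literature.RingTheory.DedekindDomain.UnitsAtCofinitelyManyPrimes       -- ★ `eventually_isUnit_algebraMap_valuationSubringAtPrime`
import HarnessLib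

/-!
# Limits of schemes: a finite group action on the generic fibre, spread to a stage `Spec A[1/t]`, RESTRICTS to every `A`-algebra in which
# `t` is a unit — hence to the localisations `𝒳.localise w` of a global model for almost all `w` (EGA IV₃ 8.8.2.5; SGA 1 V §1)

Topic `Literature/AlgebraicGeometry/Limits`; namespaces `Literature.AlgebraicGeometry.Limits.LocApprox` (§1–§3) and `Literature.AlgebraicGeometry.Limits`
(§4–§5).  THEOREMS ONLY (no definition, no named fact, no instance, no notation, no `sorry`).  FILE 2∕2 of the hand EQV-SPREAD of cell
`hodgecm-mathlib`, P6 «MOD programme», P6a ED.-2 census 8396c07d §3∕§4 (`stub_EQV : EquivariantSpreadCofinite` of `Lines/F0_P6a_ModuliDatum.lean`;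
owner A-p03 (g27) = FILE 1∕2 ★ `Limits/LocalizationActionSpread`, second A-p01 (g23) = this file, by the owner's cut).  FILE 1 spreads a finite
group `ρ : H →* Aut (P ⊗ Spec K)` of automorphisms of the GENERIC fibre of a flat separated finitely presented `A`-scheme `P` (`A` a domain,
`K = Frac A`) to a group `σ` of automorphisms over some stage `Spec A[1∕t]` (★ `LocApprox.exists_monoidHom_aut_stage`); this file carries `σ` from
the stage to EVERY commutative `A`-algebra `T` in which `t` is a unit, reads the result on the tower `(P ⊗_A T) ⊗_T K ≅ P ⊗_A K`, and concludes the
letter for global models over `𝓞 F`: for all but finitely many `w` the action extends to `𝒳.localise w` (★ `IntegralModel.localise`) compatibly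
with the generic action through `(𝒳.localise w).genericIso'` — the binders `θ`, `_hθ` of the UP letter `RecordModuliPointwiseCoreUpstairsCofinal`.
HC_CM is proved only modulo the printed citations until rung 0 closes; nothing here is about HC.

THE MATHEMATICS.  In the cartesian monoidal category `Over (Spec A)` (`P ⊗ Q = P ×_A Q`), a morphism `φ : P₁ ⊗ Q → P₂ ⊗ Q` OVER `Q` restricts
along any `g : Q′ → Q` to `φ|_{Q′} := (pr_{P₂} ∘ φ ∘ (P₁ × g), pr_{Q′}) : P₁ ⊗ Q′ → P₂ ⊗ Q′` over `Q′` (§1; ★ `LocApprox.res` of `Limits/StageRestriction`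
is the case of a finer stage); restriction is functorial in `φ`, so a group `σ : H →* Aut (P ⊗ Q)` of `Q`-automorphisms restricts to an ACTION of
`H` on `P ⊗ Q′` over `Q′` (§2; [SGA1] V §1: base change of a scheme with a group of operators).  For `Q = Spec A[1∕t]` and `Q′ = Spec T` with
`t ∈ Tˣ` (`g = Spec` of Mathlib `IsLocalization.Away.lift`) the restricted action agrees on the generic fibre `P ⊗ Spec K` — along ANY `A`-morphism
`ι : Spec K → Spec T`, since `Spec A[1∕t] → Spec A` is a monomorphism — with whatever `σ` restricts to there (§3): this is how an action spread out
to a dense open `D(t)` ([EGAIV3] 8.8.2.5) is read over the local rings `𝒪_{F,(w)}`, `w ∤ t`.  An identity `(P × ι) ∘ Φ = Ψ ∘ (P × ι)` between a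
`T`-endomorphism `Φ` of `P ⊗_A T` and a `K`-endomorphism `Ψ` of `P ⊗_A K` is the commutative square `(Φ ⊗_T K) ∘ tower = tower ∘ Ψ` through the
tower isomorphism `(P ⊗_A T) ⊗_T K ≅ P ⊗_A K` ([GortzWedhorn2020] Prop. 4.16; §4, on underlying schemes by `pullback.hom_ext` — never a
functor-level tower isomorphism, which the kernel does not digest).  §5 assembles: conjugate `τ` by `𝒳.genericIso`, FILE 1, «a non-zero `t ∈ 𝓞 F`
is a unit in `𝒪_{F,(w)}` for almost all `w`» (★ `Literature.RingTheory.DedekindDomain.eventually_isUnit_algebraMap_valuationSubringAtPrime`;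
[StacksProject] 081F ∕ 0C0C), §3 at `T = 𝒪_{F,(w)}`, §4.

MAIN STATEMENTS.  §1 `lift_whiskerLeft_comp_whiskerLeft`, `lift_whiskerLeft_id`, `lift_whiskerLeft_comp`; §2 **`exists_actionOver_restrict`**;
§3 **`exists_actionOver_specOver_of_isUnit`** (stage → every `T` with `t ∈ Tˣ`, an `ActionOver (snd P (specOver A T)).left H` — definitionally an
action on Mathlib's `pullback.snd P.hom (Spec T → Spec A)` = `((baseChange A T).obj P).hom` — with the generic square along every `ι`);
§4 **`baseChange_map_comp_towerIsoOver_hom_of_whiskerLeft`**; §5 **`IntegralModel.eventually_exists_actionOver_localise`** = the letter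
`EquivariantSpreadCofinite`.

## References
* [EGAIV3] A. Grothendieck, J. Dieudonné, *EGA* IV₃, Publ. Math. IHÉS 28 (1966), Thm. 8.8.2 (i) and 8.8.2.5.
* [SGA1] A. Grothendieck, *SGA 1*, Exp. V §1 (schemes with a finite group of operators; base change).
* [GortzWedhorn2020] U. Görtz, T. Wedhorn, *Algebraic Geometry I* (2nd ed., 2020), Thm. 10.63, Cor. 10.64 (pp. 328–329); Prop. 4.16 and §(4.8).
-/

noncomputable section

set_option backward.isDefEq.respectTransparency false

universe u

open CategoryTheory CategoryTheory.Limits AlgebraicGeometry MonoidalCategory CartesianMonoidalCategory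
open Literature.AlgebraicGeometry.Motives (SchemeOver specOver baseChange)
open Literature.AlgebraicGeometry.RelativeSpec (ActionOver)

namespace Literature.AlgebraicGeometry.Limits

namespace LocApprox

/-! ## §1 Restriction of a morphism over `Q` along `g : Q′ ⟶ Q` -/

section ResAlong

variable {A : Type u} [CommRing A] {P₁ P₂ P₃ Q Q' : SchemeOver A} (g : Q' ⟶ Q)

/-- **The defining square of restriction along `g`**: for `φ : P₁ ⊗ Q → P₂ ⊗ Q` over `Q`, the restriction
`lift ((P₁ ◁ g) ≫ φ ≫ fst) snd : P₁ ⊗ Q′ → P₂ ⊗ Q′` followed by `P₂ ◁ g` is `(P₁ ◁ g) ≫ φ` (componentwise). [cite: SGA1, Exp. V §1]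
[cite: GortzWedhorn2020, Thm. 10.63] -/
@[reassoc]
theorem lift_whiskerLeft_comp_whiskerLeft (φ : P₁ ⊗ Q ⟶ P₂ ⊗ Q) (hφ : φ ≫ snd _ _ = snd _ _) :
    lift ((P₁ ◁ g) ≫ φ ≫ fst P₂ Q) (snd P₁ Q') ≫ (P₂ ◁ g) = (P₁ ◁ g) ≫ φ := by
  apply CartesianMonoidalCategory.hom_ext
  · rw [Category.assoc, whiskerLeft_fst, lift_fst, Category.assoc]
  · rw [Category.assoc, whiskerLeft_snd, lift_snd_assoc, Category.assoc, hφ, whiskerLeft_snd]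

/-- Restriction along `g` of the identity is the identity. [cite: SGA1, Exp. V §1] -/
theorem lift_whiskerLeft_id : lift ((P₁ ◁ g) ≫ 𝟙 (P₁ ⊗ Q) ≫ fst P₁ Q) (snd P₁ Q') = 𝟙 (P₁ ⊗ Q') := by
  apply CartesianMonoidalCategory.hom_ext
  · rw [lift_fst, Category.id_comp, whiskerLeft_fst, Category.id_comp]
  · rw [lift_snd, Category.id_comp]

/-- **Restriction along `g` is functorial**: the restriction of `φ ≫ ψ` is the composite of the restrictions (for `φ` over `Q`).
[cite: SGA1, Exp. V §1] [cite: GortzWedhorn2020, Thm. 10.63] -/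
theorem lift_whiskerLeft_comp (φ : P₁ ⊗ Q ⟶ P₂ ⊗ Q) (ψ : P₂ ⊗ Q ⟶ P₃ ⊗ Q) (hφ : φ ≫ snd _ _ = snd _ _) :
    lift ((P₁ ◁ g) ≫ (φ ≫ ψ) ≫ fst P₃ Q) (snd P₁ Q') =
      lift ((P₁ ◁ g) ≫ φ ≫ fst P₂ Q) (snd P₁ Q') ≫ lift ((P₂ ◁ g) ≫ ψ ≫ fst P₃ Q) (snd P₂ Q') := by
  apply CartesianMonoidalCategory.hom_ext
  · simp only [Category.assoc, lift_fst]
    rw [lift_whiskerLeft_comp_whiskerLeft_assoc g φ hφ]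
  · simp only [Category.assoc, lift_snd]

end ResAlong

/-! ## §2 A family of automorphisms over `Q` with the group law restricts along `g : Q′ ⟶ Q` to an action over `Q′` -/

section Action

variable {A : Type u} [CommRing A] {P Q Q' : SchemeOver A} (g : Q' ⟶ Q) {H : Type*} [Group H]

/-- **Restricting an action along `g : Q′ → Q`** ([SGA1] V §1, base change of a scheme with operators): a family of `Q`-automorphisms
`σ_h : P ⊗ Q ≅ P ⊗ Q` (`h ∈ H`) with `σ_{gh} = σ_h ≫ σ_g` (the convention of Mathlib's `Aut`, `f * g = g ≫ f`) restricts to an ACTION of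
`H` on `P ⊗ Q′` over `Q′` — an `ActionOver (snd P Q′).left H` — whose automorphisms are the restrictions
`lift ((P ◁ g) ≫ σ_h ≫ fst) snd`. [cite: SGA1, Exp. V §1] -/
theorem exists_actionOver_restrict (σ : H → (P ⊗ Q ≅ P ⊗ Q)) (hσ : ∀ h, (σ h).hom ≫ snd P Q = snd P Q)
    (hσmul : ∀ g' h : H, (σ (g' * h)).hom = (σ h).hom ≫ (σ g').hom) :
    ∃ θ : ActionOver (snd P Q').left H,
      ∀ h : H, (θ.aut h).hom = (lift ((P ◁ g) ≫ (σ h).hom ≫ fst P Q) (snd P Q')).left := by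
  -- `σ 1 = 𝟙` (from the group law, `σ 1` being an isomorphism)
  have hσone : (σ 1).hom = 𝟙 _ := by
    have h1 : (σ (1 * 1)).hom = (σ 1).hom ≫ (σ 1).hom := hσmul 1 1
    rw [mul_one] at h1
    have h2 : (σ 1).hom ≫ (σ 1).inv = ((σ 1).hom ≫ (σ 1).hom) ≫ (σ 1).inv := by rw [← h1]
    rwa [Iso.hom_inv_id, Category.assoc, Iso.hom_inv_id, Category.comp_id, eq_comm] at h2
  -- the restricted morphisms and their laws
  have hid : lift ((P ◁ g) ≫ (σ 1).hom ≫ fst P Q) (snd P Q') = 𝟙 _ := by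
    rw [hσone]; exact lift_whiskerLeft_id g
  have hmul : ∀ g' h : H, lift ((P ◁ g) ≫ (σ (g' * h)).hom ≫ fst P Q) (snd P Q') =
      lift ((P ◁ g) ≫ (σ h).hom ≫ fst P Q) (snd P Q') ≫ lift ((P ◁ g) ≫ (σ g').hom ≫ fst P Q) (snd P Q') := by
    intro g' h
    rw [hσmul g' h]
    exact lift_whiskerLeft_comp g (σ h).hom (σ g').hom (hσ h)
  -- the restrictions as isomorphisms over `Q′`
  let ρ : H → (P ⊗ Q' ≅ P ⊗ Q') := fun h =>
    { hom := lift ((P ◁ g) ≫ (σ h).hom ≫ fst P Q) (snd P Q')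
      inv := lift ((P ◁ g) ≫ (σ h⁻¹).hom ≫ fst P Q) (snd P Q')
      hom_inv_id := by rw [← hmul, inv_mul_cancel, hid]
      inv_hom_id := by rw [← hmul, mul_inv_cancel, hid] }
  have hρ : ∀ h, (ρ h).hom = lift ((P ◁ g) ≫ (σ h).hom ≫ fst P Q) (snd P Q') := fun h => rfl
  have hρmul : ∀ g' h : H, (ρ (g' * h)).hom = (ρ h).hom ≫ (ρ g').hom := fun g' h => hmul g' h
  let autT : H →* Aut (P ⊗ Q').left :=
    MonoidHom.mk' (fun h => (Over.forget _).mapIso (ρ h)) fun g' h => by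
      rw [Aut.Aut_mul_def, ← Functor.mapIso_trans]
      congr 1
      exact Iso.ext (hρmul g' h)
  have hautT : ∀ h, (autT h).hom = (ρ h).hom.left := fun h => rfl
  refine ⟨⟨autT, fun h => ?_⟩, fun h => ?_⟩
  · rw [hautT, ← Over.comp_left, hρ, lift_snd]
  · rw [hautT]

end Action

/-! ## §3 From the stage `Spec A[1/t]` to every `A`-algebra `T` in which `t` is a unit -/

section Stage

variable {A : Type u} [CommRing A] (K : Type u) [Field K] [Algebra A K] [IsFractionRing A K]
  (P : SchemeOver A) {H : Type*} [Group H]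

/-- **From the stage to every `T` with `t ∈ Tˣ`** ([EGAIV3] 8.8.2.5 read over the local rings of the dense open `D(t)`; [SGA1] V §1):
let `ρ : H →* Aut (P ⊗ Spec K)` act over `Spec K` and `σ : H →* Aut (P ⊗ Spec A[1∕t])` over `Spec A[1∕t]` restrict to `ρ` along the leg
`π_t : Spec K → Spec A[1∕t]` (the output of ★ `exists_monoidHom_aut_stage`).  Then for every commutative `A`-algebra `T` in which `t` is a
unit, `H` ACTS on `P ⊗ Spec T` over `Spec T` — an `ActionOver (snd P (specOver A T)).left H`, definitionally an action on Mathlib's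
`pullback.snd P.hom (Spec T → Spec A)` — by the restrictions of the `σ_h` along `Spec T → Spec A[1∕t]` (Mathlib `IsLocalization.Away.lift`),
and this action restricts to `ρ` along EVERY `A`-morphism `ι : Spec K → Spec T` (`ι ≫ (Spec T → Spec A[1∕t]) = π_t`, the stage being an open
subscheme of `Spec A`). [cite: EGAIV3, Thm. 8.8.2 (i) and 8.8.2.5] [cite: SGA1, Exp. V §1] [cite: GortzWedhorn2020, Cor. 10.64 (2), p. 329] -/
theorem exists_actionOver_specOver_of_isUnit (ρ : H →* Aut (P ⊗ specOver A K))
    (hρ : ∀ h : H, (ρ h).hom ≫ snd _ _ = snd _ _)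
    {t : Idx (nonZeroDivisors A)} (σ : H →* Aut (P ⊗ (baseDiagram (nonZeroDivisors A)).obj t))
    (hσ : ∀ h : H, (σ h).hom ≫ snd _ _ = snd _ _)
    (hcσ : ∀ h : H, (P ◁ leg (nonZeroDivisors A) K t) ≫ (σ h).hom = (ρ h).hom ≫ (P ◁ leg (nonZeroDivisors A) K t))
    (T : Type u) [CommRing T] [Algebra A T] (hT : IsUnit (algebraMap A T t.val)) :
    ∃ θ : ActionOver (snd P (specOver A T)).left H,
      ∀ (ι : specOver A K ⟶ specOver A T) (h : H),
        (P ◁ ι).left ≫ (θ.aut h).hom = (ρ h).hom.left ≫ (P ◁ ι).left := by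
  -- the morphism `Spec T → Spec A[1/t]` over `Spec A`
  let g : specOver A T ⟶ (baseDiagram (nonZeroDivisors A)).obj t :=
    Over.homMk (Spec.map (CommRingCat.ofHom (IsLocalization.Away.lift t.val hT))) (by
      change Spec.map _ ≫ Spec.map (CommRingCat.ofHom (algebraMap A (Localization.Away t.val))) =
        Spec.map (CommRingCat.ofHom (algebraMap A T))
      rw [← Spec.map_comp, ← CommRingCat.ofHom_comp, IsLocalization.Away.lift_comp])
  -- the group law of `σ` in the `Aut` convention
  have hσmul : ∀ g' h : H, (σ (g' * h)).hom = (σ h).hom ≫ (σ g').hom := fun g' h => by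
    rw [map_mul, Aut.Aut_mul_def]; rfl
  obtain ⟨θ, hθ⟩ := exists_actionOver_restrict g (fun h => σ h) hσ hσmul
  refine ⟨θ, fun ι h => ?_⟩
  -- `ι ≫ g = π_t`: morphisms over `Spec A` into the open subscheme `Spec A[1/t]` are unique
  haveI : Mono ((baseDiagram (nonZeroDivisors A)).obj t).hom :=
    inferInstanceAs (Mono (Spec.map (CommRingCat.ofHom (algebraMap A (Localization.Away t.val)))))
  have hιg : ι ≫ g = leg (nonZeroDivisors A) K t := hom_eq_of_mono_hom _ _ _
  rw [hθ h, ← Over.comp_left, ← Over.comp_left]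
  congr 1
  apply CartesianMonoidalCategory.hom_ext
  · rw [Category.assoc, lift_fst, ← MonoidalCategory.whiskerLeft_comp_assoc, hιg, reassoc_of% (hcσ h), whiskerLeft_fst,
      Category.assoc, whiskerLeft_fst]
  · rw [Category.assoc, lift_snd, whiskerLeft_snd, Category.assoc, whiskerLeft_snd, reassoc_of% (hρ h)]

end Stage

end LocApprox

/-! ## §4 The tower reading `(P ⊗_A T) ⊗_T K ≅ P ⊗_A K` of a compatibility along `Spec K → Spec T` -/

section Tower

open Literature.AlgebraicGeometry.Motives

variable {A T K : Type} [CommRing A] [CommRing T] [Field K] [Algebra A T] [Algebra T K] [Algebra A K]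
  [IsScalarTower A T K]

/-- **Tower reading.**  Let `Φ` be a `T`-endomorphism of `P ⊗_A T`, `Ψ` a `K`-endomorphism of `P ⊗_A K`, and `ι : Spec K → Spec T` the
`A`-morphism of the tower `A → T → K`.  If `(P × ι) ∘ Φ = Ψ ∘ (P × ι)` on underlying schemes, then `Φ ⊗_T K` corresponds to `Ψ` through the
tower isomorphism `(P ⊗_A T) ⊗_T K ≅ P ⊗_A K` (★ `IntegralModel.towerIsoOver`): `(Φ ⊗_T K) ≫ tower = tower ≫ Ψ`.  Proof on underlying schemes by
`pullback.hom_ext` into `P ×_A Spec K` (first projections through `(P × ι) ≫ pr_P = pr_P`, second projections are structure maps).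
[cite: GortzWedhorn2020, Prop. 4.16 and §(4.8)] -/
theorem baseChange_map_comp_towerIsoOver_hom_of_whiskerLeft (P : SchemeOver A)
    (Φ : (baseChange A T).obj P ⟶ (baseChange A T).obj P) (Ψ : (baseChange A K).obj P ⟶ (baseChange A K).obj P)
    (ι : specOver A K ⟶ specOver A T) (hι : ι.left = Spec.map (CommRingCat.ofHom (algebraMap T K)))
    (hc : (P ◁ ι).left ≫ Φ.left = Ψ.left ≫ (P ◁ ι).left) :
    (baseChange T K).map Φ ≫ (IntegralModel.towerIsoOver P).hom = (IntegralModel.towerIsoOver P).hom ≫ Ψ := by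
  apply Over.OverMorphism.ext
  rw [Over.comp_left, Over.comp_left, IntegralModel.towerIsoOver_hom_left]
  -- the projections of `P ×_A Spec T`, `P ×_A Spec K`, `(P ×_A Spec T) ×_T Spec K` in Mathlib's `pullback` currency
  have i1 : (P ◁ ι).left ≫ pullback.fst P.hom (Spec.map (CommRingCat.ofHom (algebraMap A T))) =
      pullback.fst P.hom (Spec.map (CommRingCat.ofHom (algebraMap A K))) :=
    Over.whiskerLeft_left_fst ι
  have i2 : (P ◁ ι).left ≫ pullback.snd P.hom (Spec.map (CommRingCat.ofHom (algebraMap A T))) =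
      pullback.snd P.hom (Spec.map (CommRingCat.ofHom (algebraMap A K))) ≫ ι.left :=
    Over.whiskerLeft_left_snd ι
  have f1 : ((baseChange T K).map Φ).left ≫
        pullback.fst (pullback.snd P.hom (Spec.map (CommRingCat.ofHom (algebraMap A T))))
          (Spec.map (CommRingCat.ofHom (algebraMap T K))) =
      pullback.fst (pullback.snd P.hom (Spec.map (CommRingCat.ofHom (algebraMap A T))))
          (Spec.map (CommRingCat.ofHom (algebraMap T K))) ≫ Φ.left :=
    pullback.lift_fst _ _ _
  have e1 : ((baseChange T K).map Φ).left ≫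
        pullback.snd (pullback.snd P.hom (Spec.map (CommRingCat.ofHom (algebraMap A T))))
          (Spec.map (CommRingCat.ofHom (algebraMap T K))) =
      pullback.snd (pullback.snd P.hom (Spec.map (CommRingCat.ofHom (algebraMap A T))))
          (Spec.map (CommRingCat.ofHom (algebraMap T K))) :=
    Over.w _
  have e2 : Ψ.left ≫ pullback.snd P.hom (Spec.map (CommRingCat.ofHom (algebraMap A K))) =
      pullback.snd P.hom (Spec.map (CommRingCat.ofHom (algebraMap A K))) :=
    Over.w _
  -- `(P × ι)` read through the tower isomorphism: it is the first projection `(P ×_A T) ×_T K → P ×_A T`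
  have hPι : (IntegralModel.towerLeftIso (R := T) (K := K) P).hom ≫ (P ◁ ι).left =
      pullback.fst (pullback.snd P.hom (Spec.map (CommRingCat.ofHom (algebraMap A T))))
        (Spec.map (CommRingCat.ofHom (algebraMap T K))) := by
    -- (no `change`-reassociation of scheme morphisms: the kernel re-checks such conversions by unfolding `Scheme` composition)
    apply pullback.hom_ext
    · rw [Category.assoc]
      erw [i1]
      rw [IntegralModel.towerLeftIso_hom_fst]
      rfl
    · rw [Category.assoc]
      erw [i2]
      rw [IntegralModel.towerLeftIso_hom_snd_assoc, hι]
      exact pullback.condition.symm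
  apply pullback.hom_ext
  · rw [Category.assoc, Category.assoc, IntegralModel.towerLeftIso_hom_fst, reassoc_of% f1, ← reassoc_of% hPι,
      reassoc_of% hc, i1]
  · rw [Category.assoc, Category.assoc, IntegralModel.towerLeftIso_hom_snd, e1, e2, IntegralModel.towerLeftIso_hom_snd]

end Tower

/-! ## §5 Number fields: the letter `EquivariantSpreadCofinite` — a finite group action on `X` spreads to `𝒳.localise w` for almost all `w` -/

section NumberField

open Literature.AlgebraicGeometry.Motives IsDedekindDomain
open scoped NumberField
open Literature.NumberTheory.EllipticCurves (genericFibre)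

variable {F : Type} [Field F] [NumberField F] {X : SchemeOver F} {H : Type*} [Group H] [Finite H]

/-- **Letter `EquivariantSpreadCofinite` (P6a ED. 2, `stub_EQV`)** — EQUIVARIANT SPREADING TO ALMOST ALL PRIMES ([EGAIV3] 8.8.2 (i),
8.8.2.5; [SGA1] V §1; cofinite reading [StacksProject] 081F ∕ 0C0C).  Let `X` be an `F`-scheme with an action `τ` of a finite group `H`
over `Spec F`, and `𝒳` a GLOBAL integral model of `X` over `𝓞 F` whose total space is quasi-compact, quasi-separated, locally of finite
presentation, flat and separated over `Spec 𝓞 F`.  Then for all but finitely many primes `w`, `H` acts on the localisation `𝒳.localise w`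
(★ `IntegralModel.localise`) over `Spec 𝒪_{F,(w)}` by an action `θ` whose generic fibre, read through `(𝒳.localise w).genericIso'`, is `τ`.
Proof: conjugate `τ` by `𝒳.genericIso` to an action on `𝒳 ⊗ Spec F` over `Spec F`; spread it to a group action over a stage `Spec 𝓞F[1∕t]`
(★ `LocApprox.exists_monoidHom_aut_stage`: finitely many automorphisms spread, group law by schematic density on the flat separated model);
`t` is a unit in `𝒪_{F,(w)}` for almost all `w` (★ `eventually_isUnit_algebraMap_valuationSubringAtPrime`) and there the action restricts to `𝒳 ⊗ 𝒪_{F,(w)} = 𝒳.localise w`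
(`LocApprox.exists_actionOver_specOver_of_isUnit`), compatibly with `τ` through the tower isomorphism
(`baseChange_map_comp_towerIsoOver_hom_of_whiskerLeft`). [cite: EGAIV3, Thm. 8.8.2 (i) and 8.8.2.5] [cite: SGA1, Exp. V §1]
[cite: StacksProject, Tags 081F, 0C0C] [cite: GortzWedhorn2020, Cor. 10.64 (2), p. 329] -/
theorem IntegralModel.eventually_exists_actionOver_localise (τ : ActionOver X.hom H) (𝒳 : IntegralModel (𝓞 F) F X)
    [QuasiCompact 𝒳.total.hom] [QuasiSeparated 𝒳.total.hom] [LocallyOfFinitePresentation 𝒳.total.hom]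
    [Flat 𝒳.total.hom] [IsSeparated 𝒳.total.hom] :
    ∀ᶠ w : HeightOneSpectrum (𝓞 F) in Filter.cofinite,
      ∃ θ : ActionOver (𝒳.localise w).total.hom H, ∀ a : H,
        (genericFibre (HeightOneSpectrum.valuationSubringAtPrime F w) F).map (Over.isoMk (θ.aut a) (θ.aut_comp a)).hom
            ≫ (𝒳.localise w).genericIso'.hom
          = (𝒳.localise w).genericIso'.hom ≫ (Over.isoMk (τ.aut a) (τ.aut_comp a)).hom := by
  classical
  -- notation: the total space `P` over `A = 𝓞 F`, `Q = Spec F` over `Spec 𝓞 F`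
  let P : SchemeOver (𝓞 F) := 𝒳.total
  let Q : SchemeOver (𝓞 F) := specOver (𝓞 F) F
  -- ### (1) the generic action `τ` read on `P ⊗ Spec F` through `𝒳.genericIso`
  let gl : X.left ≅ (P ⊗ Q).left := ((Over.forget _).mapIso 𝒳.genericIso).symm
  have hgl_hom : gl.hom ≫ (snd P Q).left = X.hom := Over.w 𝒳.genericIso.inv
  have hgl_inv : gl.inv ≫ X.hom = (snd P Q).left := Over.w 𝒳.genericIso.hom
  let kO : H → (P ⊗ Q ≅ P ⊗ Q) := fun a =>
    Over.isoMk (gl.symm ≪≫ τ.aut a ≪≫ gl) (by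
      change (gl.inv ≫ (τ.aut a).hom ≫ gl.hom) ≫ (P ⊗ Q).hom = (P ⊗ Q).hom
      rw [← Over.w (snd P Q), Category.assoc, Category.assoc, reassoc_of% hgl_hom, reassoc_of% (τ.aut_comp a),
        reassoc_of% hgl_inv])
  have hkO_left : ∀ a, (kO a).hom.left = gl.inv ≫ (τ.aut a).hom ≫ gl.hom := fun a => rfl
  have hkO : ∀ a, (kO a).hom ≫ snd P Q = snd P Q := fun a =>
    Over.OverMorphism.ext (by
      rw [Over.comp_left, hkO_left, Category.assoc, Category.assoc, hgl_hom, τ.aut_comp a, hgl_inv])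
  have hkO_mul : ∀ a b : H, (kO (a * b)).hom = (kO b).hom ≫ (kO a).hom := fun a b =>
    Over.OverMorphism.ext (by
      rw [Over.comp_left, hkO_left, hkO_left, hkO_left, map_mul, Aut.Aut_mul_def, Iso.trans_hom]
      simp only [Category.assoc, Iso.hom_inv_id_assoc])
  let ρ : H →* Aut (P ⊗ Q) :=
    MonoidHom.mk' kO fun a b => by
      rw [Aut.Aut_mul_def]
      exact Iso.ext (hkO_mul a b)
  have hρ : ∀ a, (ρ a).hom ≫ snd P Q = snd P Q := fun a => hkO a
  have hρ_left : ∀ a, (ρ a).hom.left = gl.inv ≫ (τ.aut a).hom ≫ gl.hom := fun a => rfl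
  -- ### (2) spread to a group action over a stage `Spec 𝓞F[1/t]` (FILE 1)
  obtain ⟨t, σ, hσ, hcσ⟩ := LocApprox.exists_monoidHom_aut_stage F P ρ hρ
  -- ### (3) almost every `w` inverts `t` (★ `UnitsAtCofinitelyManyPrimes`)
  filter_upwards [Literature.RingTheory.DedekindDomain.eventually_isUnit_algebraMap_valuationSubringAtPrime (K := F)
    (nonZeroDivisors.ne_zero t.mem)] with w hT
  -- ### (4) the restricted action on `P ⊗ 𝒪_{F,(w)} = (𝒳.localise w).total`
  obtain ⟨θ, hθ⟩ :
      ∃ θ : ActionOver (𝒳.localise w).total.hom H,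
        ∀ (ι : specOver (𝓞 F) F ⟶ specOver (𝓞 F) (HeightOneSpectrum.valuationSubringAtPrime F w)) (h : H),
          (P ◁ ι).left ≫ (θ.aut h).hom = (ρ h).hom.left ≫ (P ◁ ι).left :=
    LocApprox.exists_actionOver_specOver_of_isUnit F P ρ hρ σ hσ hcσ (HeightOneSpectrum.valuationSubringAtPrime F w) hT
  refine ⟨θ, fun a => ?_⟩
  -- ### (5) the generic square, read through the tower isomorphism and `𝒳.genericIso`
  let ι : specOver (𝓞 F) F ⟶ specOver (𝓞 F) (HeightOneSpectrum.valuationSubringAtPrime F w) :=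
    Over.homMk (Spec.map (CommRingCat.ofHom (algebraMap (HeightOneSpectrum.valuationSubringAtPrime F w) F)))
      IntegralModel.specMap_algebraMap_comp
  let Ψ : (baseChange (𝓞 F) F).obj P ⟶ (baseChange (𝓞 F) F).obj P :=
    𝒳.genericIso.hom ≫ (Over.isoMk (τ.aut a) (τ.aut_comp a)).hom ≫ 𝒳.genericIso.inv
  have hΨ : Ψ.left = (ρ a).hom.left := by
    rw [hρ_left]
    rfl
  have h4 := baseChange_map_comp_towerIsoOver_hom_of_whiskerLeft P (Over.isoMk (θ.aut a) (θ.aut_comp a)).hom Ψ ι rfl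
    (by rw [hΨ]; exact hθ ι a)
  -- the statement in the `baseChange ∕ towerIsoOver` currency (`genericFibre = baseChange`, `genericIso' = tower ≪≫ genericIso` by `rfl`)
  have key : (baseChange (HeightOneSpectrum.valuationSubringAtPrime F w) F).map (Over.isoMk (θ.aut a) (θ.aut_comp a)).hom ≫
      ((IntegralModel.towerIsoOver P).hom ≫ 𝒳.genericIso.hom) =
      ((IntegralModel.towerIsoOver P).hom ≫ 𝒳.genericIso.hom) ≫ (Over.isoMk (τ.aut a) (τ.aut_comp a)).hom := by
    rw [reassoc_of% h4, Category.assoc, Category.assoc, Category.assoc, Iso.inv_hom_id, Category.comp_id]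
  exact key

end NumberField

end Literature.AlgebraicGeometry.Limits

end
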